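import Mathlib
import HarnessLib
import Summits.Ventures.LatticeQCDFlow.Scaling.AcceptanceEssEightNinthsDensities

/-!
# LatticeQCDFlow / Scaling — `acc ≥ (8/9)·ESS` on a general measure space, III: the constant is
# ATTAINED (Lebesgue measure on `(0, 1]`, flat model, linear target: `ā = 2/3 = (8/9)·κ`, `κ = 3/4`)

HONEST FRAMING: exact (Metropolis-corrected) sampling algorithms for lattice gauge theory;
figures of merit are autocorrelation/cost numbers at stated couplings and volumes; no
continuum-physics claim.

Venture `LatticeQCDFlow` (cell pub-lqcd), topic `Scaling`; FANOUT row 3 (`s0-u1-a`, S0-B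
implementation A, GEN-9).  NEW WORK of the cell, not a published result; NO definition is
introduced (the witness is written out: state space `ℝ` with `μ =` Lebesgue measure restricted to
`(0, 1]`, model density `q̃ ≡ 1`, target weight `w(t) = t` on `(0, 1]` — extended by `1` off
`(0, 1]` only so that `w > 0` holds pointwise on all of `ℝ`, as Part II's hypotheses ask; the
extension is invisible to `μ`).  On a FINITE space `8/9` is a limit only (row 3's
`Scaling/AcceptanceEssEightNinthsWitness.lean`: equally likely, equally spaced weights give
`acc = (8/9 + 2/(9m(m+1)))·ESS`); on a general space it is attained, by the uniform weight law —
the tent survival function of Part I's equality case.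

## What is proved (`μ = volume.restrict (Ioc 0 1)`, `q̃ ≡ 1`, `w = (t ↦ if 0 < t then t else 1)`)

* `rampOnUnit_admissible` — the pair satisfies every hypothesis of Part II
  (`w, q̃ > 0` measurable, `w` integrable, `∫ q̃ dμ = 1`, `W₂ = ∫ (w/q̃) w dμ < ∞`);
* `rampOnUnit_Z` (`Z = ∫ w dμ = 1/2`), `rampOnUnit_W₂` (`W₂ = 1/3`),
  `integral_min_unitInterval` (`∫₀¹ min(x, y) dy = x − x²/2`), `rampOnUnit_overlap`
  (`∫∫ min(w(x)q̃(y), w(y)q̃(x)) dμ dμ = 1/3`);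
* **`rampOnUnit_eight_ninths_eq_overlap`** — `(8/9)·Z³/W₂ = ∫∫ min(w(x)q̃(y), w(y)q̃(x))`:
  EQUALITY in `eight_ninths_le_integral_integral_min_mul`;
* **`rampOnUnit_meanAccept_eq_eight_ninths_ESS`** — the normalised acceptance
  `ā = ∫∫ min(p(x)q̃(y), p(y)q̃(x)) = 2/3` with `κ = Z²/W₂ = 3/4` and `2/3 = (8/9)·(3/4)`:
  EQUALITY in `meanAccept_overlapForm_ge_eight_ninths_ESS`.

NOT CLAIMED: uniqueness of the equality case (true up to the law of `w/q̃` under `q̃ μ` being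
uniform on an interval `[0, 2Z]`, not typed); any number of ours; nothing re-scored.
-/

namespace Summit.Ventures.LatticeQCDFlow.Theory2

open MeasureTheory Set

/-! ### The unit ramp: `μ = Lebesgue on (0, 1]`, `q ≡ 1`, `w(t) = t` on `(0, 1]` (`= 1` off it) -/

/-- The ramp weight is positive everywhere. -/
theorem rampOnUnit_pos (t : ℝ) : 0 < (if 0 < t then t else (1 : ℝ)) := by
  split_ifs with h
  · exact h
  · exact one_pos

/-- The ramp weight is measurable. -/
theorem measurable_rampOnUnit : Measurable fun t : ℝ => if 0 < t then t else (1 : ℝ) :=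
  Measurable.ite measurableSet_Ioi measurable_id measurable_const

/-- **The unit ramp is admissible**: it satisfies every hypothesis of
`eight_ninths_le_integral_integral_min_mul` / `meanAccept_ge_eight_ninths_ESS` (`w, q > 0`
measurable, `w` integrable, `∫ q = 1`, `W₂ < ∞`) for `μ =` Lebesgue measure restricted to `(0, 1]`. -/
theorem rampOnUnit_admissible :
    (∀ t : ℝ, 0 < (if 0 < t then t else (1 : ℝ)))
      ∧ Measurable (fun t : ℝ => if 0 < t then t else (1 : ℝ))
      ∧ Integrable (fun t : ℝ => if 0 < t then t else (1 : ℝ)) (volume.restrict (Ioc 0 1))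
      ∧ (∀ _t : ℝ, (0 : ℝ) < 1) ∧ Measurable (fun _ : ℝ => (1 : ℝ))
      ∧ Integrable (fun _ : ℝ => (1 : ℝ)) (volume.restrict (Ioc 0 1))
      ∧ ∫ _t, (1 : ℝ) ∂(volume.restrict (Ioc (0 : ℝ) 1)) = 1
      ∧ Integrable (fun t : ℝ => (if 0 < t then t else (1 : ℝ)) / 1 * (if 0 < t then t else 1))
          (volume.restrict (Ioc 0 1)) := by
  refine ⟨rampOnUnit_pos, measurable_rampOnUnit, ?_, fun _ => one_pos, measurable_const, ?_, ?_, ?_⟩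
  · refine IntegrableOn.congr_fun (f := fun t : ℝ => t)
      (continuous_id.integrableOn_Icc.mono_set Ioc_subset_Icc_self) (fun t ht => ?_) measurableSet_Ioc
    show t = if 0 < t then t else 1
    rw [if_pos ht.1]
  · exact (continuous_const.integrableOn_Icc (a := (0:ℝ)) (b := 1)).mono_set Ioc_subset_Icc_self
  · rw [setIntegral_const, Real.volume_real_Ioc_of_le zero_le_one, smul_eq_mul]
    norm_num
  · refine IntegrableOn.congr_fun (f := fun t : ℝ => t / 1 * t)
      (((continuous_id.div_const 1).mul continuous_id).integrableOn_Icc.mono_set Ioc_subset_Icc_self)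
      (fun t ht => ?_) measurableSet_Ioc
    show t / 1 * t = (if 0 < t then t else 1) / 1 * (if 0 < t then t else 1)
    rw [if_pos ht.1]

/-- `Z = ∫ w dμ = 1/2`. -/
theorem rampOnUnit_Z : ∫ t, (if 0 < t then t else (1 : ℝ)) ∂(volume.restrict (Ioc (0 : ℝ) 1)) = 1 / 2 := by
  have e : ∫ t in Ioc (0 : ℝ) 1, (if 0 < t then t else (1 : ℝ)) = ∫ t in Ioc (0 : ℝ) 1, t :=
    setIntegral_congr_fun measurableSet_Ioc fun t ht => by
      show (if 0 < t then t else (1 : ℝ)) = t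
      rw [if_pos ht.1]
  rw [e, ← intervalIntegral.integral_of_le zero_le_one, integral_id]
  norm_num

/-- `W₂ = ∫ (w/q) w dμ = 1/3`. -/
theorem rampOnUnit_W₂ :
    ∫ t, (if 0 < t then t else (1 : ℝ)) / 1 * (if 0 < t then t else 1) ∂(volume.restrict (Ioc (0 : ℝ) 1))
      = 1 / 3 := by
  have e : ∫ t in Ioc (0 : ℝ) 1, (if 0 < t then t else (1 : ℝ)) / 1 * (if 0 < t then t else 1)
      = ∫ t in Ioc (0 : ℝ) 1, t ^ 2 :=
    setIntegral_congr_fun measurableSet_Ioc fun t ht => by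
      show (if 0 < t then t else (1 : ℝ)) / 1 * (if 0 < t then t else 1) = t ^ 2
      rw [if_pos ht.1]
      ring
  rw [e, ← intervalIntegral.integral_of_le zero_le_one, integral_pow]
  norm_num

/-- The inner overlap integral on `(0, 1]`: `∫₀¹ min(x, y) dy = x − x²/2` for `0 ≤ x ≤ 1`. -/
theorem integral_min_unitInterval {x : ℝ} (hx0 : 0 ≤ x) (hx1 : x ≤ 1) :
    ∫ y in Ioc (0 : ℝ) 1, min x y = x - x ^ 2 / 2 := by
  have hii : ∀ a b : ℝ, IntervalIntegrable (fun y : ℝ => min x y) volume a b := fun a b =>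
    (continuous_const.min continuous_id).intervalIntegrable a b
  rw [← intervalIntegral.integral_of_le zero_le_one,
    ← intervalIntegral.integral_add_adjacent_intervals (hii 0 x) (hii x 1)]
  have h1 : ∫ y in (0 : ℝ)..x, min x y = ∫ y in (0 : ℝ)..x, y :=
    intervalIntegral.integral_congr fun y hy => by
      rw [uIcc_of_le hx0] at hy
      exact min_eq_right hy.2
  have h2 : ∫ y in x..(1 : ℝ), min x y = ∫ _ in x..(1 : ℝ), x :=
    intervalIntegral.integral_congr fun y hy => by
      rw [uIcc_of_le hx1] at hy
      exact min_eq_left hy.1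
  rw [h1, h2, integral_id, intervalIntegral.integral_const, smul_eq_mul]
  ring

/-- **The overlap**: `∫∫ min(w(x)q(y), w(y)q(x)) dμ dμ = 1/3` for the unit ramp. -/
theorem rampOnUnit_overlap :
    ∫ x, ∫ y, min ((if 0 < x then x else (1 : ℝ)) * 1) ((if 0 < y then y else (1 : ℝ)) * 1)
        ∂(volume.restrict (Ioc (0 : ℝ) 1)) ∂(volume.restrict (Ioc (0 : ℝ) 1)) = 1 / 3 := by
  have e : ∫ x in Ioc (0 : ℝ) 1, ∫ y in Ioc (0 : ℝ) 1,
        min ((if 0 < x then x else (1 : ℝ)) * 1) ((if 0 < y then y else (1 : ℝ)) * 1)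
      = ∫ x in Ioc (0 : ℝ) 1, (x - x ^ 2 / 2) := by
    refine setIntegral_congr_fun measurableSet_Ioc fun x hx => ?_
    show ∫ y in Ioc (0 : ℝ) 1, min ((if 0 < x then x else (1 : ℝ)) * 1) ((if 0 < y then y else (1 : ℝ)) * 1)
      = x - x ^ 2 / 2
    rw [← integral_min_unitInterval hx.1.le hx.2]
    refine setIntegral_congr_fun measurableSet_Ioc fun y hy => ?_
    show min ((if 0 < x then x else (1 : ℝ)) * 1) ((if 0 < y then y else (1 : ℝ)) * 1) = min x y
    rw [if_pos hx.1, if_pos hy.1, mul_one, mul_one]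
  have hi1 : IntervalIntegrable (fun x : ℝ => x) volume 0 1 := continuous_id.intervalIntegrable 0 1
  have hi2 : IntervalIntegrable (fun x : ℝ => x ^ 2 / 2) volume 0 1 :=
    ((continuous_pow 2).div_const 2).intervalIntegrable 0 1
  rw [e, ← intervalIntegral.integral_of_le zero_le_one, intervalIntegral.integral_sub hi1 hi2,
    intervalIntegral.integral_div, integral_id, integral_pow]
  norm_num

/-- **`8/9` IS ATTAINED**: for the unit ramp `(8/9)·Z³/W₂ = ∫∫ min(w(x)q(y), w(y)q(x))` (both
sides `= 1/3`) — equality in `eight_ninths_le_integral_integral_min_mul`. -/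
theorem rampOnUnit_eight_ninths_eq_overlap :
    8 * (∫ t, (if 0 < t then t else (1 : ℝ)) ∂(volume.restrict (Ioc (0 : ℝ) 1))) ^ 3
        / (9 * ∫ t, (if 0 < t then t else (1 : ℝ)) / 1 * (if 0 < t then t else 1)
            ∂(volume.restrict (Ioc (0 : ℝ) 1)))
      = ∫ x, ∫ y, min ((if 0 < x then x else (1 : ℝ)) * 1) ((if 0 < y then y else (1 : ℝ)) * 1)
          ∂(volume.restrict (Ioc (0 : ℝ) 1)) ∂(volume.restrict (Ioc (0 : ℝ) 1)) := by
  rw [rampOnUnit_Z, rampOnUnit_W₂, rampOnUnit_overlap]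
  norm_num

/-- **`ā = (8/9)·κ` for the unit ramp**: the normalised equilibrium acceptance
`∫∫ min(p(x)q(y), p(y)q(x))` (`p = w/Z`) equals `2/3 = (8/9)·(Z²/W₂)` with `κ = Z²/W₂ = 3/4` —
equality in `meanAccept_overlapForm_ge_eight_ninths_ESS`. -/
theorem rampOnUnit_meanAccept_eq_eight_ninths_ESS :
    ∫ x, ∫ y, min ((if 0 < x then x else (1 : ℝ))
          / (∫ t, (if 0 < t then t else (1 : ℝ)) ∂(volume.restrict (Ioc (0 : ℝ) 1))) * 1)
        ((if 0 < y then y else (1 : ℝ))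
          / (∫ t, (if 0 < t then t else (1 : ℝ)) ∂(volume.restrict (Ioc (0 : ℝ) 1))) * 1)
        ∂(volume.restrict (Ioc (0 : ℝ) 1)) ∂(volume.restrict (Ioc (0 : ℝ) 1)) = 2 / 3
    ∧ (∫ t, (if 0 < t then t else (1 : ℝ)) ∂(volume.restrict (Ioc (0 : ℝ) 1))) ^ 2
        / (∫ t, (if 0 < t then t else (1 : ℝ)) / 1 * (if 0 < t then t else 1)
            ∂(volume.restrict (Ioc (0 : ℝ) 1))) = 3 / 4
    ∧ (2 / 3 : ℝ) = 8 / 9 * (3 / 4) := by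
  refine ⟨?_, by rw [rampOnUnit_Z, rampOnUnit_W₂]; norm_num, by norm_num⟩
  rw [rampOnUnit_Z]
  have e : ∀ x, ∫ y, min ((if 0 < x then x else (1 : ℝ)) / (1 / 2) * 1)
        ((if 0 < y then y else (1 : ℝ)) / (1 / 2) * 1) ∂(volume.restrict (Ioc (0 : ℝ) 1))
      = (∫ y, min ((if 0 < x then x else (1 : ℝ)) * 1) ((if 0 < y then y else (1 : ℝ)) * 1)
          ∂(volume.restrict (Ioc (0 : ℝ) 1))) / (1 / 2) := by
    intro x
    rw [← integral_div]
    refine integral_congr_ae (Filter.Eventually.of_forall fun y => ?_)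
    show min ((if 0 < x then x else (1 : ℝ)) / (1 / 2) * 1) ((if 0 < y then y else (1 : ℝ)) / (1 / 2) * 1)
      = min ((if 0 < x then x else (1 : ℝ)) * 1) ((if 0 < y then y else (1 : ℝ)) * 1) / (1 / 2)
    rw [← min_div_div_right (by norm_num : (0:ℝ) ≤ 1 / 2)]
    congr 1 <;> ring
  simp_rw [e]
  rw [integral_div, rampOnUnit_overlap]
  norm_num

end Summit.Ventures.LatticeQCDFlow.Theory2
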